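import Mathlib

/-!
# SoloBlind — the Bessel model case of the interpolation lemma: `Ẑ(ζ) = exp(β cos ζ)` at a complex twist

Solo-blind `AtomisticToContinuum / BoseEinsteinCondensation`, census class (i), line N16 (C3 typed);
interpolation lemma `HOME/work/frustrated_fs/interpolation.md` §7 (i) / paper §13.16 Cor. 13.21; claim C151 (K17).

Fröhlich–Spencer (CMP 81 (1981), App. B) build their admissible interpolant of the modified Bessel
weights `I_n(β) = (2π)⁻¹ ∮ e^{β cos θ − inθ} dθ` from the entire function `F(ζ) = β cos ζ`
(`Ẑ(ζ) = e^{F(ζ)}` is the twisted amplitude of the Bessel weight). The interpolation lemma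
(Lemma 13.20 / 13.20-A) abstracts that appendix to two hypotheses on `Ẑ` at a complex twist
`ζ = θ + iψ` (θ = real twist, ψ = tilt):
 (H1) on `|θ| ≤ φ₁`: `Re(−F'') ≥ (scale)/C₁`, `|F''| ≤ C₁·(scale)`, `|F'''| ≤ C₁·(scale)`;
 (H2) for `|θ| ≥ φ₁/2`: `|Ẑ(θ+iψ)| ≤ C₂ e^{−c₂·(scale)} Ẑ(iψ)`,
uniformly in the tilt `ψ`. This file certifies BOTH for the Bessel case with the local scale `β cosh ψ`
and `C₁ = 1/cos φ₁`, `C₂ = 1`, at EVERY tilt `ψ ∈ ℝ` (scale-covariant form of Cor. 13.21):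
 * `cos(θ+iψ) = cos θ cosh ψ − i sin θ sinh ψ`, `‖cos(θ+iψ)‖² = cosh²ψ − sin²θ`, `‖sin(θ+iψ)‖² = cosh²ψ − cos²θ`;
 * `F' = −β sin`, `F'' = −β cos` (so `−F'' = β cos ζ`, `F''' = β sin ζ`);
 * (H1): `β cosh ψ cos φ₁ ≤ Re(β cos(θ+iψ))` for `|θ| ≤ φ₁ ≤ π`, and `‖β cos(θ+iψ)‖, ‖β sin(θ+iψ)‖ ≤ β cosh ψ`;
 * (H2): `‖exp(β cos(θ+iψ))‖ = exp(−β cosh ψ (1 − cos θ)) · ‖exp(β cos(iψ))‖`, hence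
   `≤ exp(−β(1−c)) · ‖exp(β cos(iψ))‖` whenever `cos θ ≤ c ≤ 1` — Gaussian/far smallness in the
   real twist relative to the untwisted amplitude AT THE SAME TILT, for every tilt;
 * the tilted saddle of App. B: with `Λ(ψ) = β cosh ψ`, tilted mean `m(ψ) = −β sinh ψ`, the saddle tilt
   `ψ(u) = −arsinh(u/β)` solves `m(ψ(u)) = u` and has curvature `a(u) = β cosh ψ(u) = √(β²+u²)` —
   the data of FS81's `L_β(u)` ((B.11)).
Companion of K14/K15 (Villain case). No axioms beyond Mathlib; sorry-free.
-/

open Complex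

namespace Summit.AtomisticToContinuum.BoseEinsteinCondensation.Theorems

/-- `cos` at the complex twist `θ + iψ`. -/
theorem besselTwist_cos_eq (θ ψ : ℝ) :
    Complex.cos (θ + ψ * I)
      = ((Real.cos θ * Real.cosh ψ : ℝ) : ℂ) - ((Real.sin θ * Real.sinh ψ : ℝ) : ℂ) * I := by
  rw [Complex.cos_add, Complex.cos_mul_I, Complex.sin_mul_I]
  push_cast
  ring

/-- `sin` at the complex twist `θ + iψ`. -/
theorem besselTwist_sin_eq (θ ψ : ℝ) :
    Complex.sin (θ + ψ * I)
      = ((Real.sin θ * Real.cosh ψ : ℝ) : ℂ) + ((Real.cos θ * Real.sinh ψ : ℝ) : ℂ) * I := by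
  rw [Complex.sin_add, Complex.cos_mul_I, Complex.sin_mul_I]
  push_cast
  ring

/-- `Re cos(θ+iψ) = cos θ cosh ψ`. -/
theorem besselTwist_cos_re (θ ψ : ℝ) :
    (Complex.cos (θ + ψ * I)).re = Real.cos θ * Real.cosh ψ := by
  rw [besselTwist_cos_eq]
  simp only [Complex.sub_re, Complex.mul_re, Complex.ofReal_re, Complex.ofReal_im,
    Complex.I_re, Complex.I_im, mul_zero, mul_one, sub_zero]

/-- `Im cos(θ+iψ) = −sin θ sinh ψ`. -/
theorem besselTwist_cos_im (θ ψ : ℝ) :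
    (Complex.cos (θ + ψ * I)).im = -(Real.sin θ * Real.sinh ψ) := by
  rw [besselTwist_cos_eq]
  simp only [Complex.sub_im, Complex.mul_im, Complex.ofReal_re, Complex.ofReal_im,
    Complex.I_re, Complex.I_im, mul_zero, mul_one, zero_sub, add_zero]

/-- `Re sin(θ+iψ) = sin θ cosh ψ`. -/
theorem besselTwist_sin_re (θ ψ : ℝ) :
    (Complex.sin (θ + ψ * I)).re = Real.sin θ * Real.cosh ψ := by
  rw [besselTwist_sin_eq]
  simp only [Complex.add_re, Complex.mul_re, Complex.ofReal_re, Complex.ofReal_im,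
    Complex.I_re, Complex.I_im, mul_zero, mul_one, sub_zero, add_zero]

/-- `Im sin(θ+iψ) = cos θ sinh ψ`. -/
theorem besselTwist_sin_im (θ ψ : ℝ) :
    (Complex.sin (θ + ψ * I)).im = Real.cos θ * Real.sinh ψ := by
  rw [besselTwist_sin_eq]
  simp only [Complex.add_im, Complex.mul_im, Complex.ofReal_re, Complex.ofReal_im,
    Complex.I_re, Complex.I_im, mul_zero, mul_one, add_zero, zero_add]

/-- `‖cos(θ+iψ)‖² = cosh²ψ − sin²θ`. -/
theorem besselTwist_cos_normSq (θ ψ : ℝ) :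
    Complex.normSq (Complex.cos (θ + ψ * I)) = Real.cosh ψ ^ 2 - Real.sin θ ^ 2 := by
  rw [Complex.normSq_apply, besselTwist_cos_re, besselTwist_cos_im]
  have h1 := Real.cosh_sq ψ
  have h2 := Real.sin_sq_add_cos_sq θ
  linear_combination (-(Real.sin θ) ^ 2) * h1 + (Real.cosh ψ) ^ 2 * h2

/-- `‖sin(θ+iψ)‖² = cosh²ψ − cos²θ`. -/
theorem besselTwist_sin_normSq (θ ψ : ℝ) :
    Complex.normSq (Complex.sin (θ + ψ * I)) = Real.cosh ψ ^ 2 - Real.cos θ ^ 2 := by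
  rw [Complex.normSq_apply, besselTwist_sin_re, besselTwist_sin_im]
  have h1 := Real.cosh_sq ψ
  have h2 := Real.sin_sq_add_cos_sq θ
  linear_combination (-(Real.cos θ) ^ 2) * h1 + (Real.cosh ψ) ^ 2 * h2

/-- (H1 b) model: `‖cos(θ+iψ)‖ ≤ cosh ψ` at every twist and tilt. -/
theorem besselTwist_norm_cos_le (θ ψ : ℝ) : ‖Complex.cos (θ + ψ * I)‖ ≤ Real.cosh ψ := by
  have h : ‖Complex.cos (θ + ψ * I)‖ ^ 2 ≤ Real.cosh ψ ^ 2 := by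
    rw [Complex.sq_norm, besselTwist_cos_normSq]
    nlinarith [sq_nonneg (Real.sin θ)]
  have hc := Real.cosh_pos ψ
  have hn := norm_nonneg (Complex.cos (θ + ψ * I))
  nlinarith [h, hc, hn]

/-- (H1 c) model: `‖sin(θ+iψ)‖ ≤ cosh ψ` at every twist and tilt. -/
theorem besselTwist_norm_sin_le (θ ψ : ℝ) : ‖Complex.sin (θ + ψ * I)‖ ≤ Real.cosh ψ := by
  have h : ‖Complex.sin (θ + ψ * I)‖ ^ 2 ≤ Real.cosh ψ ^ 2 := by
    rw [Complex.sq_norm, besselTwist_sin_normSq]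
    nlinarith [sq_nonneg (Real.cos θ)]
  have hc := Real.cosh_pos ψ
  have hn := norm_nonneg (Complex.sin (θ + ψ * I))
  nlinarith [h, hc, hn]

/-- The derivatives of `F = β cos`: `F' = −β sin`. -/
theorem besselTwist_deriv (β : ℝ) :
    deriv (fun ζ : ℂ => (β : ℂ) * Complex.cos ζ) = fun ζ => -((β : ℂ) * Complex.sin ζ) := by
  funext ζ
  rw [((Complex.hasDerivAt_cos ζ).const_mul (β : ℂ)).deriv]
  ring

/-- `F'' = −β cos`, i.e. `−F''(ζ) = β cos ζ`. -/
theorem besselTwist_deriv_two (β : ℝ) :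
    deriv (deriv (fun ζ : ℂ => (β : ℂ) * Complex.cos ζ)) = fun ζ => -((β : ℂ) * Complex.cos ζ) := by
  rw [besselTwist_deriv]
  funext ζ
  have hfun : (fun ζ : ℂ => -((β : ℂ) * Complex.sin ζ)) = -(fun ζ : ℂ => (β : ℂ) * Complex.sin ζ) := rfl
  rw [hfun, (((Complex.hasDerivAt_sin ζ).const_mul (β : ℂ)).neg).deriv]

/-- `F''' = β sin`. -/
theorem besselTwist_deriv_three (β : ℝ) :
    deriv (deriv (deriv (fun ζ : ℂ => (β : ℂ) * Complex.cos ζ)))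
      = fun ζ => (β : ℂ) * Complex.sin ζ := by
  rw [besselTwist_deriv_two]
  funext ζ
  have hfun : (fun ζ : ℂ => -((β : ℂ) * Complex.cos ζ)) = -(fun ζ : ℂ => (β : ℂ) * Complex.cos ζ) := rfl
  rw [hfun, (((Complex.hasDerivAt_cos ζ).const_mul (β : ℂ)).neg).deriv]
  ring

/-- (H1 a) model, scale-covariant: on the twist window `|θ| ≤ φ₁ ≤ π`,
`Re(−F''(θ+iψ)) = β cos θ cosh ψ ≥ (β cosh ψ)·cos φ₁` at every tilt `ψ`. -/
theorem besselTwist_re_negDerivTwo_lower {β φ₁ θ : ℝ} (ψ : ℝ) (hβ : 0 ≤ β)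
    (hθ : |θ| ≤ φ₁) (hφ : φ₁ ≤ Real.pi) :
    β * Real.cosh ψ * Real.cos φ₁ ≤ ((β : ℂ) * Complex.cos (θ + ψ * I)).re := by
  have hcos : Real.cos φ₁ ≤ Real.cos θ := by
    rw [← Real.cos_abs θ]
    exact Real.cos_le_cos_of_nonneg_of_le_pi (abs_nonneg θ) hφ hθ
  simp only [Complex.mul_re, Complex.ofReal_re, Complex.ofReal_im, zero_mul, sub_zero,
    besselTwist_cos_re]
  have hc := Real.cosh_pos ψ
  have := mul_le_mul_of_nonneg_left hcos (mul_nonneg hβ hc.le)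
  nlinarith [this]

/-- (H1 a,b) model: `Re(−F'') ≤ ‖F''‖ ≤ β cosh ψ` (upper ellipticity constant `1` at scale `β cosh ψ`). -/
theorem besselTwist_norm_negDerivTwo_le {β : ℝ} (θ ψ : ℝ) (hβ : 0 ≤ β) :
    ‖(β : ℂ) * Complex.cos (θ + ψ * I)‖ ≤ β * Real.cosh ψ := by
  rw [norm_mul, Complex.norm_real, Real.norm_eq_abs, abs_of_nonneg hβ]
  exact mul_le_mul_of_nonneg_left (besselTwist_norm_cos_le θ ψ) hβ

/-- (H1 c) model: `‖F'''‖ = ‖β sin(θ+iψ)‖ ≤ β cosh ψ`. -/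
theorem besselTwist_norm_derivThree_le {β : ℝ} (θ ψ : ℝ) (hβ : 0 ≤ β) :
    ‖(β : ℂ) * Complex.sin (θ + ψ * I)‖ ≤ β * Real.cosh ψ := by
  rw [norm_mul, Complex.norm_real, Real.norm_eq_abs, abs_of_nonneg hβ]
  exact mul_le_mul_of_nonneg_left (besselTwist_norm_sin_le θ ψ) hβ

/-- The modulus of the twisted Bessel amplitude: `‖exp(β cos(θ+iψ))‖ = exp(β cos θ cosh ψ)`. -/
theorem besselTwist_norm_exp (β θ ψ : ℝ) :
    ‖Complex.exp ((β : ℂ) * Complex.cos (θ + ψ * I))‖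
      = Real.exp (β * (Real.cos θ * Real.cosh ψ)) := by
  rw [Complex.norm_exp]
  congr 1
  simp only [Complex.mul_re, Complex.ofReal_re, Complex.ofReal_im, zero_mul, sub_zero,
    besselTwist_cos_re]

/-- The untwisted amplitude at tilt `ψ`: `‖exp(β cos(iψ))‖ = exp(β cosh ψ)` (`= Ẑ(iψ) = e^{Λ(ψ)}`). -/
theorem besselTwist_norm_exp_zero (β ψ : ℝ) :
    ‖Complex.exp ((β : ℂ) * Complex.cos ((0 : ℝ) + ψ * I))‖ = Real.exp (β * Real.cosh ψ) := by
  rw [besselTwist_norm_exp]; simp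

/-- (H2) model, exact form: a real twist `θ` costs the factor `exp(−β cosh ψ (1 − cos θ))`
relative to the untwisted amplitude at the same tilt. -/
theorem besselTwist_norm_exp_eq_decay (β θ ψ : ℝ) :
    ‖Complex.exp ((β : ℂ) * Complex.cos (θ + ψ * I))‖
      = Real.exp (-(β * Real.cosh ψ * (1 - Real.cos θ)))
        * ‖Complex.exp ((β : ℂ) * Complex.cos ((0 : ℝ) + ψ * I))‖ := by
  rw [besselTwist_norm_exp, besselTwist_norm_exp_zero, ← Real.exp_add]
  congr 1
  ring

/-- (H2) model, far region at every tilt: if `cos θ ≤ c ≤ 1` (e.g. `dist(θ, 2πℤ) ≥ φ₁/2`,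
`c = cos(φ₁/2)`) and `β ≥ 0`, then `‖Ẑ(θ+iψ)‖ ≤ exp(−β(1−c)) · Ẑ(iψ)` — with `C₂ = 1`, `c₂β = β(1−c)`,
uniformly in `ψ ∈ ℝ` (indeed with the better local rate `β cosh ψ (1 − c)`). -/
theorem besselTwist_far_decay {β θ c : ℝ} (ψ : ℝ) (hβ : 0 ≤ β) (hθ : Real.cos θ ≤ c) (hc : c ≤ 1) :
    ‖Complex.exp ((β : ℂ) * Complex.cos (θ + ψ * I))‖
      ≤ Real.exp (-(β * (1 - c))) * ‖Complex.exp ((β : ℂ) * Complex.cos ((0 : ℝ) + ψ * I))‖ := by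
  rw [besselTwist_norm_exp_eq_decay]
  apply mul_le_mul_of_nonneg_right _ (norm_nonneg _)
  apply Real.exp_le_exp.mpr
  have h1 := Real.one_le_cosh ψ
  have h2 : 0 ≤ 1 - c := by linarith
  have h3 : 1 - c ≤ 1 - Real.cos θ := by linarith
  have h4 : β * (1 - c) ≤ β * Real.cosh ψ * (1 - Real.cos θ) := by
    calc β * (1 - c) = β * 1 * (1 - c) := by ring
      _ ≤ β * Real.cosh ψ * (1 - c) :=
          mul_le_mul_of_nonneg_right (mul_le_mul_of_nonneg_left h1 hβ) h2
      _ ≤ β * Real.cosh ψ * (1 - Real.cos θ) :=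
          mul_le_mul_of_nonneg_left h3 (mul_nonneg hβ (le_trans zero_le_one h1))
  linarith

/-- The tilted saddle of FS81 App. B: with `Λ(ψ) = β cosh ψ` (so `m(ψ) = −Λ'(ψ) = −β sinh ψ`), the tilt
`ψ(u) := −arsinh(u/β)` solves the saddle equation `m(ψ(u)) = u`, and the saddle curvature is
`a(u) = β cosh ψ(u) = √(β² + u²)` — the Gaussian data of `L_β(u)` in (B.11). -/
theorem besselTwist_saddle {β : ℝ} (u : ℝ) (hβ : 0 < β) :
    -(β * Real.sinh (-(Real.arsinh (u / β)))) = u ∧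
      β * Real.cosh (-(Real.arsinh (u / β))) = Real.sqrt (β ^ 2 + u ^ 2) := by
  constructor
  · rw [Real.sinh_neg, Real.sinh_arsinh]
    field_simp
  · rw [Real.cosh_neg, Real.cosh_arsinh]
    rw [← Real.sqrt_sq hβ.le, ← Real.sqrt_mul (sq_nonneg β)]
    congr 1
    rw [Real.sqrt_sq hβ.le]
    field_simp

/-- Ellipticity of the tilted variance at every tilt: `Λ''(ψ) = β cosh ψ ≥ β` (lower scale `β`,
no upper bound uniform in `ψ` — the scale-covariant form of (H1) is the right one for Bessel). -/
theorem besselTwist_tiltedVariance_lower {β : ℝ} (ψ : ℝ) (hβ : 0 ≤ β) : β ≤ β * Real.cosh ψ := by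
  have := Real.one_le_cosh ψ
  nlinarith

end Summit.AtomisticToContinuum.BoseEinsteinCondensation.Theorems
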